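import Summits.QuantumFields.YangMills.Theorems.BalabanUVNodesN15KingModelCoverTorus
import Summits.QuantumFields.YangMills.Theorems.BalabanUVNodesN15KingModelToronOperator
import Literature.MathematicalPhysics.QuantumFieldTheory.King1986.MinimizerTowerBridge
import HarnessLib

/-!
# BalabanUVNodes ∕ N15 — THE KING-MODEL RUNG (PART Ͻ-c): FINITE COVERS — KING's FINE OPERATOR `−cΔ_ω + m²` AT ANY TORON DESCENDS ALONG EVERY COVERING `T_{K′} → T_K`, SO ITS
# COVARIANCE ON `T_K` IS THE FINITE IMAGE SUM OF ITS COVARIANCE ON `T_{K′}`; at `ω ≡ 1`: King's `A = 0` covariance `(lapF K)⁻¹` is the image sum of `(lapF K′)⁻¹` (finite periodisation)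
# (Track A, DAG node N15 = NE2; FAN-OUT v1.1 §N15 s3 «KING-MODEL RUNG … + what the curved case adds»; count-neutral)

HONEST FRAMING.  Count-neutral (cell `pub-ymgap`, seat `pub-ymgap-dag-n15-e` g45; `--supports stmt-QuantumFields-27247 --as helper` = K3ᴬ, KEY MAP v3).  King's `A = 0`
comparison model [King1986] on ONE finite torus `T_K = Π_μℤ∕K_μ`, FINE covariance layer, at a constant abelian (flat) link field `U(x,μ) = ω_μ` (PART Ͷ-a `toronOp K c m² ω`);
`T_{K′}` with `K_μ ∣ K′_μ` is a finite covering torus.  Exact finite-dimensional identities; NOT Bałaban's `G_k(U)` ([Balaban1985BackgroundPropagators] (3.42) untouched); NOT a node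
discharge (N15 of record untouched); nothing continuum ∕ ℝ⁴ ∕ OS ∕ Clay.

THE MATHEMATICS.  The stencil `(M_ωf)(x) = (m² + 2(d+1)c)f(x) − cΣ_μ(ω_μf(x+e_μ) + ω̄_μf(x−e_μ))` (Ͷ-a `toronOp_mulVec`) has constant coefficients, so on a pulled-back function
`f ∘ π` it acts as the pull-back of `M_ωf` (Ͻ-b `proj_add_unitVec`): `M^{K′}_ω` LIFTS `M^K_ω` (PART Ͻ-a).  Since `M^{K′}_ω` is positive definite for `|ω_μ| = 1`, `c ≥ 0`, `m² > 0`
(Ͷ-a `toronOp_posDef`), PART Ͻ-a's descent of inverses gives THE METHOD OF IMAGES FOR A FINITE COVER: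
`G^K_ω(π x̃, y) = Σ_{ỹ : π ỹ = y} G^{K′}_ω(x̃, ỹ)` — the finite analogue of the `ℤ^{d+1} → T` image sums typed in PART Ε-b ∕ Ͷ-f
(`lapF_inv_eq_tsum_freeKer` ∕ `toronOp_inv_eq_twistedImages`); cf. [Balaban1984PropagatorsI] (1.29) p.23 (torus operators as periodic operators).
PROVED HERE:
* §1 ★★ **`toronOp_lifts`** (every `ω`, every `RCLike 𝕜`, every `c, m²`: `M^{K′}_ω` lifts `M^K_ω` along `π`), `toronOp_pow_lifts`;
* §2 ★ `isUnit_toronOp`, ★★★ **`toronOp_inv_lifts`**, ★★★ **`toronOp_inv_apply_eq_sum_cover`** (`G^K_ω(π x̃, y) = Σ_{fibre} G^{K′}_ω(x̃, ỹ)`), `toronOp_inv_apply_eq_sum_cover'` (with the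
  section `lift`), ★ `norm_toronOp_inv_apply_le_sum_cover` (entry bounds descend), `toronOp_inv_sum_fiber_indep`;
* §3 KING's `U ≡ 1`: ★★ **`lapF_lifts`** (King's real `c(−Δ) + m²` on `T_{K′}` lifts the one on `T_K`, from the tree's stencil `lapF_mulVec_apply`), ★★★ **`lapF_inv_apply_eq_sum_cover`**
  (`(lapF K)⁻¹(π x̃, y) = Σ_{fibre}(lapF K′)⁻¹(x̃, ỹ)` — FINITE PERIODISATION of King's `A = 0` covariance, `c ≥ 0`, `m² > 0`), `lapF_inv_apply_le_sum_cover_abs`.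
PRIOR TREE ART (by name, not restated): Ͻ-a (`Lifts`, `Lifts.inv`, `Lifts.apply_eq_sum_fiber`, `Lifts.norm_apply_le`, `Lifts.pow`, `fiber`), Ͻ-b (`proj`, `proj_surjective`, `proj_add_unitVec`,
`proj_sub_unitVec`, `lift`, `proj_lift`), Ͷ-a (`toronOp`, `toronOp_mulVec`, `toronOp_posDef`), Ͱ-a (`lapF_det_isUnit`), `King1986.Torus` (`lapF`, `lapF_mulVec_apply`).  Dedup (rg at
filing): basename 0 files; needles `toronOp_lifts|toronOp_inv_apply_eq_sum_cover|lapF_lifts|lapF_inv_apply_eq_sum_cover` 0 tree files.  presearch: n/a (composition of in-tree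
theorems); dry-run v1 `dedup.landed` (`isUnit_lapF` ≡ `…ProperTime.isUnit_lapF` of `…GriffithsFiniteEta`) → inlined as `lapF_det_isUnit` (Ͱ-a), not redeclared.  Locators: [King1986] (4.4)
p.670; [Balaban1984PropagatorsI] (1.29) p.23; [Balaban1985BackgroundPropagators] (3.23) p.394.  0 `sorry`, 0 `def`.
v1.1 (DOC-ONLY, ERRATUM-Ͻ1 = ref-I READ-1034 N2): v1.0 cited «[King1986] §4 p.670 l.8–13» as «the method of images»; King's lines invoke [Ba 4]'s MULTIPLE-REFLECTION
representations (box propagators ∕ free boundary conditions ∕ the (2.13) operator on `ηℤ^d`, `A = 0`), not a periodisation — the finite-cover image sum is an elementary device of these files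
([folklore]); that locator is withdrawn from the affected docstrings, every other locator stands; declarations byte-identical to v1.0.
-/

noncomputable section

open scoped BigOperators ComplexConjugate ComplexOrder
open Finset Matrix

namespace Summit.QuantumFields.YangMills.BalabanUVNodes.N15KingModelRung.Cover

open Literature.MathematicalPhysics.QuantumFieldTheory.Balaban1983to89.B5Prop11Plancherel (Tor unitVec)
open Literature.MathematicalPhysics.QuantumFieldTheory.King1986.Torus (lapF lapF_mulVec_apply)
open Summit.QuantumFields.YangMills.BalabanUVNodes.N15KingModelRung.Toron (toronOp toronOp_mulVec toronOp_posDef)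
open Summit.QuantumFields.YangMills.BalabanUVNodes.N15KingModelRung.Covariant (lapF_det_isUnit)

variable {d : ℕ} {K K' : Fin (d + 1) → ℕ} [hK : ∀ μ, NeZero (K μ)] [hK' : ∀ μ, NeZero (K' μ)]

/-! ## §1 The fine operator at a toron descends along every covering -/

section Descent

variable {𝕜 : Type*} [RCLike 𝕜]

/-- ★★ **KING's FINE OPERATOR AT A TORON DESCENDS**: for every covering `π : T_{K′} → T_K` (`K_μ ∣ K′_μ`), every phase vector `ω` and all `c, m²`, the operator
`−cΔ_ω + m²` on the cover LIFTS the one on the base (`M^{K′}_ω·(f ∘ π) = (M^K_ωf) ∘ π`): the stencil has constant coefficients. [cite: King1986, (4.4) p.670; Balaban1984PropagatorsI, (1.29) p.23] -/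
theorem toronOp_lifts (h : ∀ μ, K μ ∣ K' μ) (c m2 : ℝ) (ω : Fin (d + 1) → 𝕜) :
    Lifts (proj h) (proj h) (toronOp K' c m2 ω) (toronOp K c m2 ω) := by
  intro f; funext x
  change (toronOp K' c m2 ω *ᵥ (f ∘ proj h)) x = (toronOp K c m2 ω *ᵥ f) (proj h x)
  rw [toronOp_mulVec, toronOp_mulVec]
  simp only [Function.comp_apply, proj_add_unitVec, proj_sub_unitVec]

/-- Powers descend (e.g. the terms of the heat semigroup ∕ Neumann series). [folklore] -/
theorem toronOp_pow_lifts (h : ∀ μ, K μ ∣ K' μ) (c m2 : ℝ) (ω : Fin (d + 1) → 𝕜) (n : ℕ) :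
    Lifts (proj h) (proj h) (toronOp K' c m2 ω ^ n) (toronOp K c m2 ω ^ n) :=
  (toronOp_lifts h c m2 ω).pow n

/-! ## §2 The toron covariance on the base is the image sum of the toron covariance on the cover -/

/-- ★ The toron operator is invertible (`|ω_μ| = 1`, `c ≥ 0`, `m² > 0`; Ͷ-a `toronOp_posDef`). [cite: King1986, (4.4) p.670] -/
theorem isUnit_toronOp {c m2 : ℝ} (hc : 0 ≤ c) (hm : 0 < m2) {ω : Fin (d + 1) → 𝕜} (hω : ∀ μ, ‖ω μ‖ = 1) : IsUnit (toronOp K c m2 ω) :=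
  (toronOp_posDef K hc hm hω).isUnit

/-- ★★★ **THE TORON COVARIANCE DESCENDS**: `(M^{K′}_ω)⁻¹` lifts `(M^K_ω)⁻¹` along every covering. [cite: Balaban1984PropagatorsI, (1.29) p.23] -/
theorem toronOp_inv_lifts (h : ∀ μ, K μ ∣ K' μ) {c m2 : ℝ} (hc : 0 ≤ c) (hm : 0 < m2) {ω : Fin (d + 1) → 𝕜} (hω : ∀ μ, ‖ω μ‖ = 1) :
    Lifts (proj h) (proj h) (toronOp K' c m2 ω)⁻¹ (toronOp K c m2 ω)⁻¹ :=
  (toronOp_lifts h c m2 ω).inv (proj_surjective h) (isUnit_toronOp hc hm hω)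

/-- ★★★ **THE METHOD OF IMAGES FOR A FINITE COVER**: `G^K_ω(π x̃, y) = Σ_{ỹ : π ỹ = y} G^{K′}_ω(x̃, ỹ)` for every point `x̃` of the cover — King's toron covariance on `T_K` is the sum of
the toron covariance on `T_{K′}` over the fibre. [cite: Balaban1984PropagatorsI, (1.29) p.23] -/
theorem toronOp_inv_apply_eq_sum_cover (h : ∀ μ, K μ ∣ K' μ) {c m2 : ℝ} (hc : 0 ≤ c) (hm : 0 < m2) {ω : Fin (d + 1) → 𝕜} (hω : ∀ μ, ‖ω μ‖ = 1)
    (x' : Tor K') (y : Tor K) :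
    (toronOp K c m2 ω)⁻¹ (proj h x') y = ∑ y' ∈ fiber (proj h) y, (toronOp K' c m2 ω)⁻¹ x' y' :=
  (toronOp_inv_lifts h hc hm hω).apply_eq_sum_fiber x' y

/-- The same with the canonical lift of the base point: `G^K_ω(x, y) = Σ_{ỹ : π ỹ = y} G^{K′}_ω(lift x, ỹ)`. [folklore] -/
theorem toronOp_inv_apply_eq_sum_cover' (h : ∀ μ, K μ ∣ K' μ) {c m2 : ℝ} (hc : 0 ≤ c) (hm : 0 < m2) {ω : Fin (d + 1) → 𝕜} (hω : ∀ μ, ‖ω μ‖ = 1)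
    (x y : Tor K) :
    (toronOp K c m2 ω)⁻¹ x y = ∑ y' ∈ fiber (proj h) y, (toronOp K' c m2 ω)⁻¹ (lift h x) y' := by
  conv_lhs => rw [← proj_lift h x]
  exact toronOp_inv_apply_eq_sum_cover h hc hm hω (lift h x) y

/-- The fibre sums of the cover's covariance only depend on the projected point. [folklore] -/
theorem toronOp_inv_sum_fiber_indep (h : ∀ μ, K μ ∣ K' μ) {c m2 : ℝ} (hc : 0 ≤ c) (hm : 0 < m2) {ω : Fin (d + 1) → 𝕜} (hω : ∀ μ, ‖ω μ‖ = 1)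
    {x' x'' : Tor K'} (hx : proj h x' = proj h x'') (y : Tor K) :
    ∑ y' ∈ fiber (proj h) y, (toronOp K' c m2 ω)⁻¹ x' y' = ∑ y' ∈ fiber (proj h) y, (toronOp K' c m2 ω)⁻¹ x'' y' :=
  (toronOp_inv_lifts h hc hm hω).sum_fiber_indep hx y

/-- ★ ENTRY BOUNDS DESCEND: `|G^K_ω(π x̃, y)| ≤ Σ_{fibre}|G^{K′}_ω(x̃, ỹ)|` — every entrywise majorant of the cover's covariance (decay, Kato, …) periodises to the base.
[folklore] -/
theorem norm_toronOp_inv_apply_le_sum_cover (h : ∀ μ, K μ ∣ K' μ) {c m2 : ℝ} (hc : 0 ≤ c) (hm : 0 < m2) {ω : Fin (d + 1) → 𝕜} (hω : ∀ μ, ‖ω μ‖ = 1)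
    (x' : Tor K') (y : Tor K) :
    ‖(toronOp K c m2 ω)⁻¹ (proj h x') y‖ ≤ ∑ y' ∈ fiber (proj h) y, ‖(toronOp K' c m2 ω)⁻¹ x' y'‖ :=
  (toronOp_inv_lifts h hc hm hω).norm_apply_le x' y

/-- A fibrewise majorant of the cover's covariance descends. [folklore] -/
theorem norm_toronOp_inv_apply_le_of_cover (h : ∀ μ, K μ ∣ K' μ) {c m2 : ℝ} (hc : 0 ≤ c) (hm : 0 < m2) {ω : Fin (d + 1) → 𝕜} (hω : ∀ μ, ‖ω μ‖ = 1)
    {F : Tor K' → Tor K' → ℝ} (hF : ∀ x' y', ‖(toronOp K' c m2 ω)⁻¹ x' y'‖ ≤ F x' y') (x' : Tor K') (y : Tor K) :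
    ‖(toronOp K c m2 ω)⁻¹ (proj h x') y‖ ≤ ∑ y' ∈ fiber (proj h) y, F x' y' :=
  (toronOp_inv_lifts h hc hm hω).norm_apply_le_sum hF x' y

end Descent

/-! ## §3 King's `U ≡ 1` covariance: finite periodisation -/

section KingFree

/-- ★★ **KING's `c(−Δ) + m²` DESCENDS** (real matrices): `lapF K′ c m²` lifts `lapF K c m²` along every covering `T_{K′} → T_K` (the tree's stencil `lapF_mulVec_apply`).
[cite: King1986, (4.4) p.670] -/
theorem lapF_lifts (h : ∀ μ, K μ ∣ K' μ) (c m2 : ℝ) : Lifts (proj h) (proj h) (lapF K' c m2) (lapF K c m2) := by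
  intro f; funext x
  change (lapF K' c m2 *ᵥ (f ∘ proj h)) x = (lapF K c m2 *ᵥ f) (proj h x)
  rw [lapF_mulVec_apply, lapF_mulVec_apply]
  simp only [Function.comp_apply, proj_add_unitVec, proj_sub_unitVec]

/-- ★★ The `A = 0` covariance descends: `(lapF K′)⁻¹` lifts `(lapF K)⁻¹`. [folklore] -/
theorem lapF_inv_lifts (h : ∀ μ, K μ ∣ K' μ) {c m2 : ℝ} (hc : 0 ≤ c) (hm : 0 < m2) : Lifts (proj h) (proj h) (lapF K' c m2)⁻¹ (lapF K c m2)⁻¹ :=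
  (lapF_lifts h c m2).inv (proj_surjective h) ((Matrix.isUnit_iff_isUnit_det _).mpr (lapF_det_isUnit K' hc hm))

/-- ★★★ **FINITE PERIODISATION OF KING's `A = 0` COVARIANCE**: `(c(−Δ)+m²)⁻¹_{T_K}(π x̃, y) = Σ_{ỹ : π ỹ = y} (c(−Δ)+m²)⁻¹_{T_{K′}}(x̃, ỹ)` — the finite-cover form of King's
«torus propagator = sum over images» ([King1986]; the infinite cover `ℤ^{d+1} → T` is PART Ε-b's `lapF_inv_eq_tsum_freeKer`). [cite: Balaban1984PropagatorsI, (1.29) p.23] -/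
theorem lapF_inv_apply_eq_sum_cover (h : ∀ μ, K μ ∣ K' μ) {c m2 : ℝ} (hc : 0 ≤ c) (hm : 0 < m2) (x' : Tor K') (y : Tor K) :
    (lapF K c m2)⁻¹ (proj h x') y = ∑ y' ∈ fiber (proj h) y, (lapF K' c m2)⁻¹ x' y' :=
  (lapF_inv_lifts h hc hm).apply_eq_sum_fiber x' y

/-- With the canonical lift: `(lapF K)⁻¹(x, y) = Σ_{fibre}(lapF K′)⁻¹(lift x, ỹ)`. [folklore] -/
theorem lapF_inv_apply_eq_sum_cover' (h : ∀ μ, K μ ∣ K' μ) {c m2 : ℝ} (hc : 0 ≤ c) (hm : 0 < m2) (x y : Tor K) :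
    (lapF K c m2)⁻¹ x y = ∑ y' ∈ fiber (proj h) y, (lapF K' c m2)⁻¹ (lift h x) y' := by
  conv_lhs => rw [← proj_lift h x]
  exact lapF_inv_apply_eq_sum_cover h hc hm (lift h x) y

/-- A fibrewise majorant of the cover's `A = 0` covariance descends to the base (e.g. the tree's exponential decay bounds on `T_{K′}`). [folklore] -/
theorem abs_lapF_inv_apply_le_of_cover (h : ∀ μ, K μ ∣ K' μ) {c m2 : ℝ} (hc : 0 ≤ c) (hm : 0 < m2) {F : Tor K' → Tor K' → ℝ}
    (hF : ∀ x' y', |(lapF K' c m2)⁻¹ x' y'| ≤ F x' y') (x' : Tor K') (y : Tor K) :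
    |(lapF K c m2)⁻¹ (proj h x') y| ≤ ∑ y' ∈ fiber (proj h) y, F x' y' := by
  have h1 := (lapF_inv_lifts h hc hm).norm_apply_le_sum (F := F) (fun x' y' => by rw [Real.norm_eq_abs]; exact hF x' y') x' y
  rwa [Real.norm_eq_abs] at h1

end KingFree

end Summit.QuantumFields.YangMills.BalabanUVNodes.N15KingModelRung.Cover

end
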